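import Literature.RingTheory.Etale.LiftNilpotentThickening
import Mathlib.RingTheory.Smooth.Basic
import Mathlib.RingTheory.Unramified.Basic
import HarnessLib

/-!
# Morphisms between nilpotent lifts of étale algebras (SGA 1 I 5.5, 8.3 — affine functoriality)

Topic `Literature/RingTheory/Etale`; theorems only; sequel to `LiftNilpotentThickening` (existence
of lifts). An *étale lift* of an `R₀ = R ⧸ N`-algebra `B₀` (`N` nilpotent) is an étale `R`-algebra
`B` with a surjection `φ : B → B₀` of kernel `N B`. This file provides what is needed to GLUE such
lifts over a scheme (SGA 1 I 8.3: «il résulte du théorème d'unicité I 5.5 que ces solutions se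
recollent»):

* `exists_finite_etale_lift` — the existence theorem in surjection form (`π : R → R₀` surjective
  with nilpotent kernel, `B₀` finite étale over `R₀`);
* `ringHom_ext_of_nilpotent_ker`, `exists_ringHom_comp_eq`, `existsUnique_ringHom_of_lift` —
  **I 5.5 for algebras**: maps out of a formally étale algebra into a nilpotent lift are uniquely
  determined by, and exist for, their reductions (Mathlib's infinitesimal lifting
  `Algebra.FormallySmooth.liftOfSurjective`, `Algebra.FormallyUnramified.ext'`, repackaged for ring
  maps over a change of base `t : R → R'`, which is the form restriction to a smaller affine open
  takes);
* `isLocalization_away_of_lift` — **lifts localise**: if `(B, φ)` lifts `B₀` over `R` and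
  `(B', φ')` lifts `B₀[1/f]` over `R[1/f]`, the canonical transition map `B → B'` exhibits
  `B' = B[1/f]`. (Proof: `B[1/f]` is itself an étale lift of `B₀[1/f]`; two étale lifts are
  isomorphic by the existence and uniqueness above, and the isomorphism is compatible with the
  transition map by uniqueness again.) This is the «quasi-coherence» of the sheaf of lifted
  algebras,
  i.e. the hypothesis `Coequifibered` of Mathlib's relative-`Spec` constructor
  `Scheme.AffineZariskiSite.relativeGluingData`.

These feed the scheme-level statement (finite étale covers lift along nilpotent thickenings,
`AlgebraicGeometry/FundamentalGroup/FiniteEtaleNilpotentLift`), the reduction «`X ↦ X_red`» in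
Riemann's existence theorem SGA 1 XII 5.1 (named fact `riemannExistence_finiteCovering`).

## References

* [SGA1] A. Grothendieck, M. Raynaud, *SGA 1* (LNM 224 / arXiv:math/0206203), Exp. I Thm. 5.5,
  Prop. 8.1, Thm. 8.3 (pp. 7, 13–15 of the original; p0012, p0016–p0017 of the materialised
  text).
* A. Grothendieck, *EGA* IV₄ 18.1.2.

#harness_tags algebraic_geometry.etale, ring_theory.deformation
-/

noncomputable section

namespace Literature.RingTheory.Etale

universe u v w

/-- **Surjection form of `exists_finite_etale_of_finite_etale_quotient`.** For a surjective ring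
map `π : R → R₀` with nilpotent kernel and a finite étale `R₀`-algebra `B₀` (an `R`-algebra through
`π`), there is a finite étale `R`-algebra `B` with an `R`-algebra surjection `B → B₀` of kernel
`(ker π) B`. [cite: SGA1, Exp. I Prop. 8.1 and Thm. 8.3] -/
theorem exists_finite_etale_lift {R R₀ : Type u} [CommRing R] [CommRing R₀] (π : R →+* R₀)
    (hπ : Function.Surjective π) (hker : IsNilpotent (RingHom.ker π))
    (B₀ : Type v) [CommRing B₀] [Algebra R₀ B₀] [Algebra R B₀]
    (hsc : ∀ r, algebraMap R B₀ r = algebraMap R₀ B₀ (π r))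
    [Algebra.Etale R₀ B₀] [Module.Finite R₀ B₀] :
    ∃ (B : Type u) (_ : CommRing B) (_ : Algebra R B), Algebra.Etale R B ∧ Module.Finite R B ∧
      ∃ φ : B →ₐ[R] B₀, Function.Surjective φ ∧
        RingHom.ker φ.toRingHom = Ideal.map (algebraMap R B) (RingHom.ker π) := by
  set N := RingHom.ker π with hN
  -- `R ⧸ N ≃ R₀`, and `B₀` as an `R ⧸ N`-algebra
  let e : R ⧸ N ≃+* R₀ := RingHom.quotientKerEquivOfSurjective hπ
  letI : Algebra (R ⧸ N) R₀ := e.toRingHom.toAlgebra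
  letI : Algebra (R ⧸ N) B₀ := ((algebraMap R₀ B₀).comp e.toRingHom).toAlgebra
  haveI : IsScalarTower (R ⧸ N) R₀ B₀ := IsScalarTower.of_algebraMap_eq fun _ ↦ rfl
  haveI : IsScalarTower R (R ⧸ N) B₀ := IsScalarTower.of_algebraMap_eq fun r ↦ by
    rw [hsc]
    rfl
  -- `R₀` is étale (an isomorphism) over `R ⧸ N`, hence `B₀` is finite étale over `R ⧸ N`
  let e' : (R ⧸ N) ≃ₐ[R ⧸ N] R₀ :=
    { e with commutes' := fun _ ↦ rfl }
  haveI : Algebra.Etale (R ⧸ N) R₀ := Algebra.Etale.of_equiv e'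
  haveI : Algebra.Etale (R ⧸ N) B₀ := Algebra.Etale.comp (R ⧸ N) R₀ B₀
  haveI : Module.Finite (R ⧸ N) R₀ := Module.Finite.equiv e'.toLinearEquiv
  haveI : Module.Finite (R ⧸ N) B₀ := Module.Finite.trans R₀ B₀
  exact exists_finite_etale_of_finite_etale_quotient N hker B₀

section Hom

variable {R : Type*} [CommRing R] {B B' C : Type*} [CommRing B] [CommRing B'] [CommRing C]
  [Algebra R B] [Algebra R B']

/-- **Uniqueness of morphisms between nilpotent lifts** (the affine I 5.5): two `R`-algebra maps
`B → B'` from a formally unramified `B` which agree after a ring map `φ' : B' → C` with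
nilpotent kernel are equal (Mathlib `Algebra.FormallyUnramified.ext'`, restated for ring maps
with an explicit compatibility with the structure maps). [cite: SGA1, Exp. I Thm. 5.5] -/
theorem ringHom_ext_of_nilpotent_ker [Algebra.FormallyUnramified R B] (φ' : B' →+* C)
    (hφ' : IsNilpotent (RingHom.ker φ')) {ρ₁ ρ₂ : B →+* B'}
    (h₁ : ρ₁.comp (algebraMap R B) = algebraMap R B')
    (h₂ : ρ₂.comp (algebraMap R B) = algebraMap R B')
    (h : φ'.comp ρ₁ = φ'.comp ρ₂) : ρ₁ = ρ₂ := by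
  let a₁ : B →ₐ[R] B' := { ρ₁ with commutes' := fun r ↦ RingHom.congr_fun h₁ r }
  let a₂ : B →ₐ[R] B' := { ρ₂ with commutes' := fun r ↦ RingHom.congr_fun h₂ r }
  have : a₁ = a₂ :=
    Algebra.FormallyUnramified.ext' φ' hφ' a₁ a₂ fun x ↦ RingHom.congr_fun h x
  exact RingHom.ext fun x ↦ congr($this x)

/-- **Existence of morphisms between nilpotent lifts**: for `B` formally smooth over `R`, a
surjection `φ' : B' → C` of `R`-algebras with nilpotent kernel, and an `R`-algebra map
`ψ : B → C`, there is a ring map `ρ : B → B'` over `R` with `φ' ∘ ρ = ψ` (Mathlib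
`Algebra.FormallySmooth.liftOfSurjective`). [cite: SGA1, Exp. I Thm. 5.5 and Prop. 8.1] -/
theorem exists_ringHom_comp_eq [Algebra.FormallySmooth R B] [Algebra R C] (φ' : B' →ₐ[R] C)
    (hφ's : Function.Surjective φ') (hφ' : IsNilpotent (RingHom.ker φ'.toRingHom)) (ψ : B →ₐ[R] C) :
    ∃ ρ : B →+* B', ρ.comp (algebraMap R B) = algebraMap R B' ∧
      φ'.toRingHom.comp ρ = ψ.toRingHom := by
  let ρ := Algebra.FormallySmooth.liftOfSurjective ψ φ' hφ's hφ'
  refine ⟨ρ.toRingHom, RingHom.ext fun r ↦ ρ.commutes r, RingHom.ext fun x ↦ ?_⟩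
  exact Algebra.FormallySmooth.liftOfSurjective_apply ψ φ' hφ's hφ' x

/-- **Transition maps between nilpotent lifts, packaged.** Let `B` be formally étale over `R`,
`t : R → R'` a ring map, `φ' : B' → C'` a surjection of `R'`-algebras with nilpotent kernel and
`ψ : B → C'` a ring map compatible with the structure maps. Then there is a UNIQUE ring map
`ρ : B → B'` over `t` with `φ' ∘ ρ = ψ` (existence: formal smoothness; uniqueness: formal
unramifiedness). This is how the local lifts of SGA 1 I 8.1 glue («il résulte du théorème
d'unicité I 5.5 que ces solutions se recollent», proof of I 8.3).
[cite: SGA1, Exp. I Thm. 5.5 and Thm. 8.3 (proof)] -/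
theorem existsUnique_ringHom_of_lift {R' B₁ C₁ : Type*} [CommRing R'] [CommRing B₁]
    [CommRing C₁] [Algebra.FormallySmooth R B] [Algebra.FormallyUnramified R B] (t : R →+* R')
    [Algebra R' B₁] [Algebra R' C₁] (φ' : B₁ →ₐ[R'] C₁) (hφ's : Function.Surjective φ')
    (hφ' : IsNilpotent (RingHom.ker φ'.toRingHom)) (ψ : B →+* C₁)
    (hψ : ψ.comp (algebraMap R B) = (algebraMap R' C₁).comp t) :
    ∃! ρ : B →+* B₁, ρ.comp (algebraMap R B) = (algebraMap R' B₁).comp t ∧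
      φ'.toRingHom.comp ρ = ψ := by
  letI : Algebra R B₁ := ((algebraMap R' B₁).comp t).toAlgebra
  letI : Algebra R C₁ := ((algebraMap R' C₁).comp t).toAlgebra
  let φ'' : B₁ →ₐ[R] C₁ := { φ'.toRingHom with commutes' := fun r ↦ φ'.commutes (t r) }
  let ψ' : B →ₐ[R] C₁ := { ψ with commutes' := fun r ↦ RingHom.congr_fun hψ r }
  obtain ⟨ρ, h1, h2⟩ := exists_ringHom_comp_eq φ'' hφ's hφ' ψ'
  refine ⟨ρ, ⟨h1, h2⟩, fun ρ' hρ' ↦ ?_⟩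
  exact ringHom_ext_of_nilpotent_ker (R := R) φ'.toRingHom hφ' hρ'.1 h1 (hρ'.2.trans h2.symm)

end Hom

section Localization

/-- **Nilpotent lifts localise** (the sheaf property behind SGA 1 I 8.3): let `(B, φ)` be an
étale lift over `R` of `B₀ = B ⧸ N B` and `(Bf, φf)` an étale lift over `R[1/f]` of `B₀[1/f]`
(`N`, `Nf` nilpotent). Then the unique structure-compatible ring map `ρ : B → Bf` lifting
`B₀ → B₀[1/f]` exhibits `Bf` as the localisation `B[1/f]`: indeed `B[1/f]` is itself an étale
lift of `B₀[1/f]` over `R[1/f]`, and two étale lifts are uniquely isomorphic (I 5.5).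
[cite: SGA1, Exp. I Thm. 8.3 (proof: «ces solutions se recollent»), Thm. 5.5] -/
theorem isLocalization_away_of_lift {R Rf B Bf B₀ B₀f : Type*} [CommRing R] [CommRing Rf]
    [CommRing B] [CommRing Bf] [CommRing B₀] [CommRing B₀f] [Algebra R Rf] (f : R)
    [IsLocalization.Away f Rf] [Algebra R B] [Algebra.Etale R B] (N : Ideal R) [Algebra R B₀]
    (φ : B →ₐ[R] B₀) [Algebra Rf Bf] [Algebra.Etale Rf Bf] (Nf : Ideal Rf) [Algebra Rf B₀f]
    (φf : Bf →ₐ[Rf] B₀f) [Algebra B₀ B₀f] [IsLocalization.Away (algebraMap R B₀ f) B₀f]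
    [Algebra R B₀f] [IsScalarTower R Rf B₀f] [IsScalarTower R B₀ B₀f]
    (hN : IsNilpotent N) (hφ : Function.Surjective φ)
    (hkerφ : RingHom.ker φ.toRingHom = N.map (algebraMap R B)) (hNf : IsNilpotent Nf)
    (hφf : Function.Surjective φf) (hkerφf : RingHom.ker φf.toRingHom = Nf.map (algebraMap Rf Bf))
    (ρ : B →+* Bf) (hρ₁ : ρ.comp (algebraMap R B) = (algebraMap Rf Bf).comp (algebraMap R Rf))
    (hρ₂ : φf.toRingHom.comp ρ = (algebraMap B₀ B₀f).comp φ.toRingHom) :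
    letI := ρ.toAlgebra
    IsLocalization.Away (algebraMap R B f) Bf := by
  classical
  set F : B := algebraMap R B f with hF
  let L := Localization.Away F
  -- `L` as an `Rf`-algebra
  have hunit : ∀ y : Submonoid.powers f, IsUnit (((algebraMap B L).comp (algebraMap R B)) y) := by
    rintro ⟨_, n, rfl⟩
    rw [map_pow]
    exact (IsLocalization.Away.algebraMap_isUnit F).pow n
  let iL : Rf →+* L := IsLocalization.lift (M := Submonoid.powers f) hunit
  have hiL : ∀ r, iL (algebraMap R Rf r) = algebraMap B L (algebraMap R B r) := fun r ↦
    IsLocalization.lift_eq hunit r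
  letI : Algebra Rf L := iL.toAlgebra
  haveI : IsScalarTower R Rf L := IsScalarTower.of_algebraMap_eq fun r ↦ by
    rw [RingHom.algebraMap_toAlgebra, hiL, ← IsScalarTower.algebraMap_apply]
  haveI : Algebra.Etale R Rf := Algebra.Etale.of_isLocalizationAway f
  haveI : Algebra.Etale Rf L := Algebra.Etale.of_restrictScalars R Rf L
  -- `φL : L → B₀f`
  let ψ : B →+* B₀f := (algebraMap B₀ B₀f).comp φ.toRingHom
  have hψF : ∀ n : ℕ, ψ (F ^ n) = algebraMap B₀ B₀f (algebraMap R B₀ f ^ n) := by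
    intro n
    simp [ψ, hF]
  have hψunit : ∀ y : Submonoid.powers F, IsUnit (ψ y) := by
    rintro ⟨_, n, rfl⟩
    rw [hψF, map_pow]
    exact (IsLocalization.Away.algebraMap_isUnit (algebraMap R B₀ f)).pow n
  let φL : L →+* B₀f := IsLocalization.lift (M := Submonoid.powers F) hψunit
  have hφL : ∀ b, φL (algebraMap B L b) = ψ b := fun b ↦ IsLocalization.lift_eq hψunit b
  have hφLi : ∀ r : Rf, φL (algebraMap Rf L r) = algebraMap Rf B₀f r := by
    intro r
    change (φL.comp iL) r = _
    congr 1
    refine IsLocalization.ringHom_ext (Submonoid.powers f) (RingHom.ext fun a ↦ ?_)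
    rw [RingHom.comp_apply, RingHom.comp_apply, hiL, hφL]
    simp only [ψ, RingHom.comp_apply, AlgHom.toRingHom_eq_coe, RingHom.coe_coe, AlgHom.commutes]
    rw [← IsScalarTower.algebraMap_apply, ← IsScalarTower.algebraMap_apply]
  -- `N` kills `B₀f`
  have hNψ : ∀ n ∈ N, ψ (algebraMap R B n) = 0 := by
    intro n hn
    have : algebraMap R B n ∈ RingHom.ker φ.toRingHom := by
      rw [hkerφ]
      exact Ideal.mem_map_of_mem _ hn
    rw [RingHom.mem_ker] at this
    simp only [ψ, RingHom.comp_apply]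
    rw [this, map_zero]
  -- `φL` is surjective
  have hφLsurj : Function.Surjective φL := by
    intro y
    obtain ⟨⟨b₀, ⟨_, n, rfl⟩⟩, hy⟩ :=
      IsLocalization.surj (Submonoid.powers (algebraMap R B₀ f)) y
    obtain ⟨b, rfl⟩ := hφ b₀
    dsimp only at hy
    refine ⟨IsLocalization.mk' L b ⟨F ^ n, Submonoid.mem_powers_iff _ _ |>.mpr ⟨n, rfl⟩⟩, ?_⟩
    rw [IsLocalization.lift_mk'_spec]
    change ψ b = ψ (F ^ n) * y
    rw [hψF, mul_comm, hy]
    rfl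
  -- `ker φL = N L`
  have hkerL : RingHom.ker φL = N.map (algebraMap R L) := by
    apply le_antisymm
    · intro x hx
      obtain ⟨⟨b, s⟩, rfl⟩ := IsLocalization.mk'_surjective (Submonoid.powers F) x
      rw [RingHom.mem_ker] at hx
      replace hx : ψ b = 0 := by
        have := (IsLocalization.lift_mk'_spec (hg := hψunit) b 0 s).mp hx
        rwa [mul_zero] at this
      have hb : algebraMap B₀ B₀f (φ b) = 0 := hx
      obtain ⟨⟨_, k, rfl⟩, hk⟩ :=
        (IsLocalization.map_eq_zero_iff (Submonoid.powers (algebraMap R B₀ f)) B₀f _).mp hb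
      dsimp only at hk
      have hFb : F ^ k * b ∈ N.map (algebraMap R B) := by
        rw [← hkerφ, RingHom.mem_ker]
        change φ (F ^ k * b) = 0
        rwa [map_mul, map_pow, hF, AlgHom.commutes]
      let c : Submonoid.powers F := ⟨F ^ k, Submonoid.mem_powers_iff _ _ |>.mpr ⟨k, rfl⟩⟩
      have hx' : IsLocalization.mk' L b s = IsLocalization.mk' L (b * (c : B)) (s * c) :=
        (IsLocalization.mk'_cancel _ _ _).symm
      show IsLocalization.mk' L b s ∈ _
      rw [hx', IsLocalization.mk'_eq_mul_mk'_one]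
      refine Ideal.mul_mem_right _ _ ?_
      rw [IsScalarTower.algebraMap_eq R B L, ← Ideal.map_map]
      refine Ideal.mem_map_of_mem _ ?_
      change b * F ^ k ∈ _
      rw [mul_comm]
      exact hFb
    · rw [Ideal.map_le_iff_le_comap]
      intro n hn
      rw [Ideal.mem_comap, RingHom.mem_ker, IsScalarTower.algebraMap_apply R B L, hφL]
      exact hNψ n hn
  have hkerLnil : IsNilpotent (RingHom.ker φL) := by
    rw [hkerL]
    obtain ⟨k, hk⟩ := hN
    exact ⟨k, by rw [← Ideal.map_pow, hk, Ideal.zero_eq_bot, Ideal.map_bot, Ideal.zero_eq_bot]⟩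
  have hkerfnil : IsNilpotent (RingHom.ker φf.toRingHom) := by
    rw [hkerφf]
    obtain ⟨k, hk⟩ := hNf
    exact ⟨k, by rw [← Ideal.map_pow, hk, Ideal.zero_eq_bot, Ideal.map_bot, Ideal.zero_eq_bot]⟩
  -- the comparison maps `σ : L → Bf`, `τ : Bf → L` over `Rf`
  let φLa : L →ₐ[Rf] B₀f := { φL with commutes' := hφLi }
  have hφLa : φLa.toRingHom = φL := rfl
  obtain ⟨σ, hσ₁, hσ₂⟩ := exists_ringHom_comp_eq (R := Rf) (B := L) φf hφf hkerfnil φLa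
  obtain ⟨τ, hτ₁, hτ₂⟩ :=
    exists_ringHom_comp_eq (R := Rf) (B := Bf) φLa hφLsurj (by rw [hφLa]; exact hkerLnil) φf
  rw [hφLa] at hσ₂ hτ₂
  have hτσ : τ.comp σ = RingHom.id L := by
    refine ringHom_ext_of_nilpotent_ker (R := Rf) (B := L) φL hkerLnil ?_ (RingHom.id_comp _) ?_
    · rw [RingHom.comp_assoc, hσ₁, hτ₁]
    · rw [← RingHom.comp_assoc, hτ₂, hσ₂, RingHom.comp_id]
  have hστ : σ.comp τ = RingHom.id Bf := by
    refine ringHom_ext_of_nilpotent_ker (R := Rf) (B := Bf) φf.toRingHom hkerfnil ?_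
      (RingHom.id_comp _) ?_
    · rw [RingHom.comp_assoc, hτ₁, hσ₁]
    · rw [← RingHom.comp_assoc, hσ₂, hτ₂, RingHom.comp_id]
  let e : L ≃+* Bf := RingEquiv.ofRingHom σ τ hστ hτσ
  -- `ρ = σ ∘ (B → L)` by uniqueness
  letI algRBf : Algebra R Bf := ((algebraMap Rf Bf).comp (algebraMap R Rf)).toAlgebra
  have hρσ : ρ = σ.comp (algebraMap B L) := by
    refine ringHom_ext_of_nilpotent_ker (R := R) (B := B) φf.toRingHom hkerfnil hρ₁ ?_ ?_
    · ext r
      change σ (algebraMap B L (algebraMap R B r)) = algebraMap Rf Bf (algebraMap R Rf r)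
      rw [← hiL]
      exact RingHom.congr_fun hσ₁ (algebraMap R Rf r)
    · rw [hρ₂, ← RingHom.comp_assoc, hσ₂]
      exact RingHom.ext fun b ↦ (hφL b).symm
  -- conclusion: transport along `e`
  letI := ρ.toAlgebra
  let ea : L ≃ₐ[B] Bf :=
    { e with
      commutes' := fun b ↦ by
        change σ (algebraMap B L b) = ρ b
        rw [hρσ]
        rfl }
  exact IsLocalization.isLocalization_of_algEquiv (Submonoid.powers F) ea

end Localization

end Literature.RingTheory.Etale

end
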